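import Summits.CriticalPhenomena.CardyFormulaZ2.Theses.CardyFlipRusso
import Summits.CriticalPhenomena.CardyFormulaZ2.Theorems.UnionJackBeffaraUnionJackEndgame
import Summits.CriticalPhenomena.CardyFormulaZ2.Theorems.CardyFlipRussoCoveringLegRobust
import Summits.CriticalPhenomena.CardyFormulaZ2.Theorems.CardyFlipRussoCoveringLegStubFrameBridgeShift
import Literature.Probability.Percolation.CardyFormulaConformalInvariance
import Literature.Barriers.CriticalPhenomena.CoveringLatticeShift
import HarnessLib.Audit.Check

/-!
# Line `shared-cruxes-bridge` — ALTERNATIVE checked skeleton for the crux `Target`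
(item stmt-CriticalPhenomena-6431, rank-0 auto-crux of route `CardyFlipRusso`, sub-problem `CardyFormulaZ2`;
crux-strategist s1 `planner-cstrat-stmt-CriticalPhenomena-6431-s1-0`, 2026-08-17; card `Lines/shared-cruxes-bridge.md`,
census `STRATEGY-CENSUS.md`, split package `SPLIT-Target.md`).  PUBLISHED, deliberately NOT registered with
`ledger skeleton check` (registration would replace the live lead's skeleton pointer `Lines/Sketch.lean` v7); the lead may
adopt it at a cycle boundary.

## The cut

`Target` is DEFINITIONALLY `VoronoiCardy ∧ GsCardy` (lead's `target_iff`, `Iff.rfl`):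
(i) Cardy for annealed Poisson–Voronoi percolation, (ii) Cardy for critical site percolation on `G_s` (crude, frame A).
Both conjuncts already have STAFFED homes elsewhere, and the only piece of mathematics that belongs to THIS node is an
embedding bridge:

* STUB 1 `stub_open_voronoiHubFromSmirnov` — the route's own crux `CardyFlipRusso.VoronoiHubFromSmirnov`
  (stmt-CriticalPhenomena-6433) BY NAME: Smirnov's theorem ⟹ conjunct (i).  OPEN (Benjamini–Schramm); live line
  `moebius-exact-delaunay-dilation-ward` (3 registered stubs, 54 helper files landed).  Smirnov's theorem is PROVED in the tree
  (`hasCrossingLimit_triDomainCrossingProb_holds`), so this stub IS conjunct (i) (`voronoiHubFromSmirnov_iff_voronoiCardy` in the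
  strategist's evidence `CardyFlipRussoTargetSplit.lean`).  Not to be proved inside this line: park `blocked-on: stmt-6433`.
* STUB 2 `stub_open_unionJackMorera` — the shared crux `UnionJackBeffara.UnionJackMorera` (stmt-CriticalPhenomena-4558) BY NAME:
  Smirnov separating families sandwich the crude `P_{1/2,1/2}` site crossing of `δG_s` in the Union-Jack frame.  OPEN; live line on
  route UnionJackBeffara (stubs `stub_ujSeparatingData`, `stub_ujDiscreteMorera`); wanted also by DWavePairKernel.  By the LANDED
  `unionJackEndgame_proof` it gives Cardy's formula for `ujCrossingProb half` (Union-Jack crude crossings).  Park `blocked-on: stmt-4558`.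
* STUB 3 `stub_gsCardyOfUnionJack` — **the line's own content, provable now (L)**: Cardy for the Union-Jack crude crossings
  (all conformal rectangles) ⟹ conjunct (ii).  Frame change = rotation by `π/4`, mesh `δ ↦ δ/√2`, half-cell translation, slack
  `2√2δ` vs `2δ`.  In the vocabulary of the landed robustness machinery (`Theorems/CardyFlipRussoCoveringLeg{Defs,RobustDefs,
  ShiftDefs,Robust,StubFrameBridgeShift}.lean`, crux `CoveringLeg`, p142502): hypothesis = `∀ R, HasCrossingLimit (fun δ =>
  (lawP half).real (wideS R δ)) cardyFunction` (by `ujCrossingProb_eq_letForm`, `ujCrossingProb_eq_wideS` and the reparametrisation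
  `δ ↦ √2δ` of `𝓝[>] 0`); conclusion `SiteCardy` = `CardyHalfShift` read backwards through the EXACT dictionary
  `shift_lawP_half_crossS : (lawP ½).real (crossS (R ⊕ δ·i/√2) δ) = siteProb (ρ⁻¹R) δ`; and `WideCardy → CardyHalfShift` is the
  collar sandwich of `robust_of_stubs` run in the opposite direction: liminf by a WIDE-slack crossing of the lower comparison quad
  `Q` of `R` being a `2δ`-slack crossing of `R ⊕ a`, `‖a‖ ≤ δ` (the proof of `stub_lowerInclusion` verbatim: the slack enters only
  through "endpoints in `cthickening r (Q.arc i)`", and `2√2δ ≤ 3δ ≤ r`); limsup by "a CLOSED wide-slack crossing of the upper quad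
  `N` excludes an open `2δ`-slack crossing of `R ⊕ a`" (the proof of `stub_blocking_of_planar` with the roles of the two slacks
  exchanged) + flip invariance (`stub_flipBound` for `wideS`) + `stub_cyclicFlip` + `stub_cardyContinuity` (tree).  No RSW.

`Target_of` composes: `⟨stub 1 applied to Smirnov's theorem, stub 3 (unionJackEndgame_proof (stub 2))⟩` — the crux BY NAME.
Honest reading: after stub 3 lands, `Target` is `blocked-on: stmt-6433, stmt-4558` and carries no mathematics of its own; the
route's `closes` consumes only conjunct (ii), i.e. (with `coveringLeg_of_ujbMixedInterpolation`, p142502) exactly the Union-Jack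
programme stmt-4558 + stmt-4559 plus bridges.

Disproof honoured: none exists for this crux (no `Cruxes/Target/Disproof.lean`, no `Theorems/Target/Negative/`, 2026-08-17).
-/

noncomputable section

namespace Summit.CriticalPhenomena.CardyFormulaZ2.Cruxes.Target.SharedCruxesBridge

open scoped BigOperators Topology Classical MeasureTheory ProbabilityTheory
open Filter Set Function TopologicalSpace MeasureTheory
open Summit.CriticalPhenomena.CardyFormulaZ2.Theses

/-! ### The line's one new statement, named -/

/-- **The embedding bridge** (= the split child `GsCardyOfUnionJack`, verbatim): Cardy's formula for the Union-Jack crude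
site crossings of `δG_s` (all conformal rectangles; hypothesis = the conclusion of `UnionJackBeffara.UnionJackEndgame`)
implies Cardy's formula for the frame-A crude site crossings (conjunct (ii) of `Target`). A route-posited statement of this
line (provable now, L); nothing asserted here. -/
def GsCardyOfUnionJack : Prop :=
  (let Z : Literature.Barriers.CriticalPhenomena.MixedSite → ℂ := fun v => Sum.elim (fun x : ℤ × ℤ => (((x.1 + x.2 : ℤ) : ℂ) + ((x.2 - x.1 + 1 : ℤ) : ℂ) * Complex.I) / 2) (fun f : ℤ × ℤ => (((f.1 + f.2 + 1 : ℤ) : ℂ) + ((f.2 + 1 - f.1 : ℤ) : ℂ) * Complex.I) / 2) v; let G : SimpleGraph Literature.Barriers.CriticalPhenomena.MixedSite := SimpleGraph.fromRel fun u v => ∃ x : ℤ × ℤ, u = Sum.inl x ∧ (v = Sum.inl (x.1 + 1, x.2) ∨ v = Sum.inl (x.1, x.2 + 1) ∨ ∃ f : ℤ × ℤ, v = Sum.inr f ∧ (x.1 = f.1 ∨ x.1 = f.1 + 1) ∧ (x.2 = f.2 ∨ x.2 = f.2 + 1)); let P : unitInterval → Literature.Probability.RandomPlanarGeometry.ConformalRectangle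 → ℝ → ℝ := fun q R δ => (Literature.Probability.LatticeModels.prodBernoulli (Literature.Barriers.CriticalPhenomena.mixedParam q)).real {ω | ∃ u v, Metric.infDist ((δ : ℂ) * Z u) (R.arc 0) ≤ 2 * δ ∧ Metric.infDist ((δ : ℂ) * Z v) (R.arc 2) ≤ 2 * δ ∧ ω ∈ Literature.Probability.Percolation.siteConnIn G {y | (δ : ℂ) * Z y ∈ R.carrier} u v}; ∀ R : Literature.Probability.RandomPlanarGeometry.ConformalRectangle, R.HasCrossingLimit (P Literature.Probability.Percolation.half R) Literature.Probability.RandomPlanarGeometry.cardyFunction) → (let z : (ℤ × ℤ) ⊕ (ℤ × ℤ) → ℂ := Sum.elim (fun x ↦ (x.1 : ℂ) + (x.2 : ℂ) * Complex.I) (fun f ↦ ((f.1 : ℂ) + 1 / 2) + ((f.2 : ℂ) + 1 / 2) * Complex.I); let G : SimpleGraph ((ℤ × ℤ) ⊕ (ℤ × ℤ)) := SimpleGraph.fromRel (fun a b ↦ a.isLeft = true ∧ ((b.isLeft = true ∧ dist (z a) (z b) = 1) ∨ (b.isRight = true ∧ dist (z a) (z b) < 1))); ∀ R : Literature.Probability.RandomPlanarGeometry.ConformalRectangle,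 R.HasCrossingLimit (fun δ ↦ (Literature.Probability.Percolation.sitePercolation ((ℤ × ℤ) ⊕ (ℤ × ℤ)) Literature.Probability.Percolation.half).real {ω | ∃ u v, Metric.infDist ((δ : ℂ) * z u) (R.arc 0) ≤ 2 * δ ∧ Metric.infDist ((δ : ℂ) * z v) (R.arc 2) ≤ 2 * δ ∧ ω ∈ Literature.Probability.Percolation.siteConnIn G {y | (δ : ℂ) * z y ∈ R.carrier} u v}) Literature.Probability.RandomPlanarGeometry.cardyFunction)

/-! ### The registered stubs (the ONLY `sorry`s of this file) -/

/-- STUB 1 — the route's crux **stmt-CriticalPhenomena-6433 BY NAME** (OPEN: Benjamini–Schramm; live line elsewhere; not to be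
proved inside this line). [cite: BenjaminiSchramm1998] -/
theorem stub_open_voronoiHubFromSmirnov : CardyFlipRusso.VoronoiHubFromSmirnov := by
  sorry

/-- STUB 2 — the shared crux **stmt-CriticalPhenomena-4558 BY NAME** (OPEN: Cardy–Smirnov families for site percolation on the
centred square lattice; live line on route UnionJackBeffara; not to be proved inside this line). [cite: Beffara2008Universal, §5.1] -/
theorem stub_open_unionJackMorera : UnionJackBeffara.UnionJackMorera := by
  sorry

/-- STUB 3 — **the embedding bridge** `GsCardyOfUnionJack` (= the split child, verbatim): Cardy's formula for the Union-Jack crude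
site crossings of `δG_s` (all conformal rectangles) implies Cardy's formula for the frame-A crude site crossings (conjunct (ii) of
`Target`).  Provable now (L): the collar sandwich of `CardyFlipRussoCoveringLegRobust.lean` run backwards, see the module
docstring. [cite: BollobasRiordan2006, Ch. 7 Lemma 14 and Claim 19] -/
theorem stub_gsCardyOfUnionJack :
    (let Z : Literature.Barriers.CriticalPhenomena.MixedSite → ℂ := fun v => Sum.elim (fun x : ℤ × ℤ => (((x.1 + x.2 : ℤ) : ℂ) + ((x.2 - x.1 + 1 : ℤ) : ℂ) * Complex.I) / 2) (fun f : ℤ × ℤ => (((f.1 + f.2 + 1 : ℤ) : ℂ) + ((f.2 + 1 - f.1 : ℤ) : ℂ) * Complex.I) / 2) v; let G : SimpleGraph Literature.Barriers.CriticalPhenomena.MixedSite := SimpleGraph.fromRel fun u v => ∃ x : ℤ × ℤ, u = Sum.inl x ∧ (v = Sum.inl (x.1 + 1, x.2) ∨ v = Sum.inl (x.1, x.2 + 1) ∨ ∃ f : ℤ × ℤ, v = Sum.inr f ∧ (x.1 = f.1 ∨ x.1 = f.1 + 1) ∧ (x.2 = f.2 ∨ x.2 = f.2 + 1)); let P : unitInterval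 → Literature.Probability.RandomPlanarGeometry.ConformalRectangle → ℝ → ℝ := fun q R δ => (Literature.Probability.LatticeModels.prodBernoulli (Literature.Barriers.CriticalPhenomena.mixedParam q)).real {ω | ∃ u v, Metric.infDist ((δ : ℂ) * Z u) (R.arc 0) ≤ 2 * δ ∧ Metric.infDist ((δ : ℂ) * Z v) (R.arc 2) ≤ 2 * δ ∧ ω ∈ Literature.Probability.Percolation.siteConnIn G {y | (δ : ℂ) * Z y ∈ R.carrier} u v}; ∀ R : Literature.Probability.RandomPlanarGeometry.ConformalRectangle, R.HasCrossingLimit (P Literature.Probability.Percolation.half R) Literature.Probability.RandomPlanarGeometry.cardyFunction) → (let z : (ℤ × ℤ) ⊕ (ℤ × ℤ) → ℂ := Sum.elim (fun x ↦ (x.1 : ℂ) + (x.2 : ℂ) * Complex.I) (fun f ↦ ((f.1 : ℂ) + 1 / 2) + ((f.2 : ℂ) + 1 / 2) * Complex.I); let G : SimpleGraph ((ℤ × ℤ) ⊕ (ℤ × ℤ)) := SimpleGraph.fromRel (fun a b ↦ a.isLeft = true ∧ ((b.isLeft = true ∧ dist (z a) (z b) = 1) ∨ (b.isRight = true ∧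 dist (z a) (z b) < 1))); ∀ R : Literature.Probability.RandomPlanarGeometry.ConformalRectangle, R.HasCrossingLimit (fun δ ↦ (Literature.Probability.Percolation.sitePercolation ((ℤ × ℤ) ⊕ (ℤ × ℤ)) Literature.Probability.Percolation.half).real {ω | ∃ u v, Metric.infDist ((δ : ℂ) * z u) (R.arc 0) ≤ 2 * δ ∧ Metric.infDist ((δ : ℂ) * z v) (R.arc 2) ≤ 2 * δ ∧ ω ∈ Literature.Probability.Percolation.siteConnIn G {y | (δ : ℂ) * z y ∈ R.carrier} u v}) Literature.Probability.RandomPlanarGeometry.cardyFunction) := by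
  sorry


/-- `stub_gsCardyOfUnionJack`'s statement is `GsCardyOfUnionJack`, definitionally. -/
theorem gsCardyOfUnionJack_of_stub : GsCardyOfUnionJack := stub_gsCardyOfUnionJack

/-! ### Composition (sorry-free; concludes the crux BY NAME) -/

/-- **`Target` from the registered stubs** — the crux `Summit.CriticalPhenomena.CardyFormulaZ2.Theses.CardyFlipRusso.Target`
BY NAME; the only `sorry`s in its cone are the three `stub_*` above.  (The same term with the three statements as HYPOTHESES is the
strategist's registered glue stub `target_of_hub_morera_bridge`, evidence `CardyFlipRussoTargetSplit.lean` on stmt-6431.) [cite: Smirnov2001, Thm 1] -/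
theorem Target_of : CardyFlipRusso.Target :=
  ⟨stub_open_voronoiHubFromSmirnov Literature.Probability.Percolation.hasCrossingLimit_triDomainCrossingProb_holds,
    stub_gsCardyOfUnionJack (Summit.CriticalPhenomena.CardyFormulaZ2.Theorems.unionJackEndgame_proof stub_open_unionJackMorera)⟩


/-! ### Calibrations (sorry-free): what each stub is -/

/-- Stub 1 IS conjunct (i) of the crux (Smirnov's theorem is proved in the tree). [cite: Smirnov2001, Thm 1] -/
theorem stub1_iff_conjunct_one : CardyFlipRusso.VoronoiHubFromSmirnov ↔ (∀ (PB PW : MeasureTheory.Measure (Literature.Analysis.FunctionSpaces.PointConfig ℂ)), Literature.Analysis.FunctionSpaces.IsPoissonPointProcess (MeasureTheory.volume : MeasureTheory.Measure ℂ) PB → Literature.Analysis.FunctionSpaces.IsPoissonPointProcess (MeasureTheory.volume : MeasureTheory.Measure ℂ) PW → ∀ R : Literature.Probability.RandomPlanarGeometry.ConformalRectangle, R.HasCrossingLimit (fun δ ↦ (PB.prod PW).real {c | ∃ x ∈ R.arc 0, ∃ y ∈ R.arc 2, JoinedIn (closure R.carrier ∩ {z | Metric.infDist (z / (δ : ℂ))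 (c.1 : Set ℂ) ≤ Metric.infDist (z / (δ : ℂ)) (c.2 : Set ℂ)}) x y}) Literature.Probability.RandomPlanarGeometry.cardyFunction) :=
  ⟨fun h => h Literature.Probability.Percolation.hasCrossingLimit_triDomainCrossingProb_holds, fun h _ => h⟩

/-- Conjunct (ii) of the crux IS `SiteCardy` of the CoveringLeg machinery (frame A), definitionally — so the landed
`robust_of_siteCardy` / `siteWideNull_of_siteCardy` / `cardyCentredSquare_of_siteCardy` are the CONVERSE bridges of stub 3.
[cite: Beffara2008Universal, §5.1] -/
theorem conjunct_two_iff_siteCardy :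
    (let z : (ℤ × ℤ) ⊕ (ℤ × ℤ) → ℂ := Sum.elim (fun x ↦ (x.1 : ℂ) + (x.2 : ℂ) * Complex.I) (fun f ↦ ((f.1 : ℂ) + 1 / 2) + ((f.2 : ℂ) + 1 / 2) * Complex.I); let G : SimpleGraph ((ℤ × ℤ) ⊕ (ℤ × ℤ)) := SimpleGraph.fromRel (fun a b ↦ a.isLeft = true ∧ ((b.isLeft = true ∧ dist (z a) (z b) = 1) ∨ (b.isRight = true ∧ dist (z a) (z b) < 1))); ∀ R : Literature.Probability.RandomPlanarGeometry.ConformalRectangle, R.HasCrossingLimit (fun δ ↦ (Literature.Probability.Percolation.sitePercolation ((ℤ × ℤ) ⊕ (ℤ × ℤ)) Literature.Probability.Percolation.half).real {ω | ∃ u v, Metric.infDist ((δ : ℂ) * z u) (R.arc 0) ≤ 2 * δ ∧ Metric.infDist ((δ : ℂ) * z v) (R.arc 2) ≤ 2 * δ ∧ ω ∈ Literature.Probability.Percolation.siteConnIn G {y | (δ : ℂ) * z y ∈ R.carrier} u v}) Literature.Probability.RandomPlanarGeometry.cardyFunction) ↔ Summit.CriticalPhenomena.CardyFormulaZ2.Cruxes.CoveringLeg.FiveArmNull.SiteCardy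 :=
  Iff.rfl

/-- The crux gives `SiteCardy` (landed `siteCardy_of_target`, restated). [cite: Beffara2008Universal, §5.1] -/
theorem siteCardy_of_crux (h : CardyFlipRusso.Target) :
    Summit.CriticalPhenomena.CardyFormulaZ2.Cruxes.CoveringLeg.FiveArmNull.SiteCardy :=
  Summit.CriticalPhenomena.CardyFormulaZ2.Cruxes.CoveringLeg.FiveArmNull.siteCardy_of_target h

end Summit.CriticalPhenomena.CardyFormulaZ2.Cruxes.Target.SharedCruxesBridge

end

#h21_check_skeleton "stmt-CriticalPhenomena-6431" Summit.CriticalPhenomena.CardyFormulaZ2.Theses.CardyFlipRusso.Target stub_open_voronoiHubFromSmirnov stub_open_unionJackMorera stub_gsCardyOfUnionJack
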